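import Literature.NumberTheory.GelbartRogawski1991.LocalUnitaryUndoublingGaloisConj
import Literature.NumberTheory.GelbartRogawski1991.LocalGaloisConjCoinvariants
import Literature.NumberTheory.GelbartRogawski1991.LocalUnitaryRationalSimilitudeCoinvariants
import HarnessLib

/-!
# The `χ`-coinvariants of the CM Weil representation under Galois conjugation: `Θ_{ξ∘bar₁}(scaleT_{−1} s_{χ′}) ≅ Θ_ξ(s_χ) ∘ bar`

Topic `NumberTheory/GelbartRogawski1991`; namespace `Literature.NumberTheory.GelbartRogawski1991.UnitaryDualPair.LocalSplitting`.  KERNEL ONLY: theorems; no definition,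
no named fact, no `sorry`.  Cell `hodgecm-mathlib` (D-0151), programme P5 (crux HLiu418 = stmt-HodgeConjecture-24832), piece **(C1)-rep** of the road card
`F0/P5/A-p18/g23/ROAD-L4if-v3.A-p18g23.md` §6 (A-p18 (g23), 2026-08-31): the COINVARIANT (theta-type) level of ★ P1u
`localSplittingCMWith_comp_localPiGalConj_eq_scaleTransportSection` combined with ★ L4 `TwistedCoinv.rep_comp_localPiGalConj_apply`.

At a NON-SPLIT `v`, for the Weil representations `ω₁ = ω ∘ s_χ^{T₀}` and `ω₂ = ω ∘ scaleTransportSection_{−1}(s_{χ′}^{−T₀})` (★ P1u: `ω₁ ∘ bar = ω₂` AS REPRESENTATIONS,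
`(χ′_w)⁻¹ = (χ_w)⁻¹ ∘ σ_w`), the centre `Z = U(J₁)(L⁺_v)` (on which `bar` acts by `bar₁`, ★ L4) and ANY character `ξ` of `Z`:
* **`exists_coinv_equiv_localPiGalConj`**: `∃ e : (ω₂)_{Z, ξ∘bar₁} ≃ (ω₁)_{Z,ξ}` with `e ∘ rep (ξ∘bar₁) ω₂ (g) = rep ξ ω₁ (ḡ) ∘ e` — in the road's words
  **`Θ_ξ(λ, a) ∘ bar ≅ Θ_{ξ∘bar₁}(λᶜ, −a)`** (`ξ ∘ bar₁ = ξ⁻¹` pointwise, ★ `TwistedCoinv.comp_localPiGalConj_rankOne_apply`).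
Nothing of the cited sources is asserted; HC_CM is proved only modulo the printed citations until rung 0 closes.

## References
* [MoeglinVignerasWaldspurger1987] LNM 1291 (1987), Chap. 2 II.2; Chap. 3 IV.
* [Liu2021] Y. Liu, App. D §D.1 Step 3 (l. 5221).
* [GelbartRogawski1991] S. Gelbart, J. Rogawski, Invent. Math. 105 (1991), §3.1 Remark p. 457 L4–13.
-/

set_option autoImplicit false
set_option Elab.async false

noncomputable section

open scoped Matrix
open NumberField IsDedekindDomain MeasureTheory Matrix
open Literature.RepresentationTheory.HeisenbergGroup
open Literature.NumberTheory.Automorphic Literature.NumberTheory.Automorphic.UnitaryGroup Literature.NumberTheory.Weil1964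
open Literature.NumberTheory.GaloisRepresentations Literature.RepresentationTheory.HarrisKudlaSweet1996
open Literature.RepresentationTheory.TwistedCoinv

namespace Literature.NumberTheory.GelbartRogawski1991.UnitaryDualPair.LocalSplitting


/-! ## §1 Generic: a pull-back `ρ₂ = ρ₁ ∘ κ` with equal relation submodules -/

section Generic

variable {k : Type*} [CommRing k] {G H S : Type*} [Group G] [Group H] [AddCommGroup S] [Module k S]

/-- **Transport of coinvariants along a pull-back.**  If `ρ₂ = ρ₁ ∘ κ` for a homomorphism `κ : G →* G` and the relation submodules of `(ρ₂|_H, χ₂)` and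
`(ρ₁|_H, χ₁)` coincide, the identity on classes is an isomorphism `(ρ₂)_{H,χ₂} ≃ (ρ₁)_{H,χ₁}` intertwining `rep χ₂ ρ₂ (g)` with `rep χ₁ ρ₁ (κ g)`.
[cite: GelbartRogawski1991, §3.1 Remark p. 457 L4–13] [cite: MoeglinVignerasWaldspurger1987, Chap. 2 II.2] -/
theorem _root_.Literature.RepresentationTheory.TwistedCoinv.exists_equiv_of_comp_of_ker_eq (ρ₁ ρ₂ : Representation k G S) (κ : G →* G)
    (hρ : ρ₂ = ρ₁.comp κ) (ι : H →* G) (χ₁ χ₂ : H →* kˣ) (hker : ker (ρ₂.comp ι) χ₂ = ker (ρ₁.comp ι) χ₁)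
    (hc₁ : ∀ (g : G) (h : H), Commute (ρ₁ g) ((ρ₁.comp ι) h)) (hc₂ : ∀ (g : G) (h : H), Commute (ρ₂ g) ((ρ₂.comp ι) h)) :
    ∃ e : Coinv (ρ₂.comp ι) χ₂ ≃ₗ[k] Coinv (ρ₁.comp ι) χ₁, ∀ (g : G) (x : Coinv (ρ₂.comp ι) χ₂), e (rep χ₂ ρ₂ hc₂ g x) = rep χ₁ ρ₁ hc₁ (κ g) (e x) := by
  refine ⟨Submodule.quotEquivOfEq _ _ hker, fun g x => ?_⟩
  obtain ⟨w, rfl⟩ := mk_surjective _ _ x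
  rw [rep_mk, mk_apply, mk_apply, Submodule.quotEquivOfEq_mk, Submodule.quotEquivOfEq_mk, hρ, MonoidHom.comp_apply]
  rfl

end Generic

/-! ## §2 The coinvariants under `bar` -/

section CM

variable (L : Type) [Field L] [NumberField L] [IsCMField L] (v : HeightOneSpectrum (𝓞 (maximalRealSubfield L)))
  [MeasurableSpace (v.adicCompletion (maximalRealSubfield L))] [BorelSpace (v.adicCompletion (maximalRealSubfield L))]
  (μ : Measure (v.adicCompletion (maximalRealSubfield L))) [μ.IsAddHaarMeasure]
  (n : ℕ) {T₀ T₀' : Matrix (Fin n) (Fin n) (maximalRealSubfield L)} {J₀ J₀' : Matrix (Fin n) (Fin n) L}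
  {T₁ : Matrix (Fin 1) (Fin 1) (maximalRealSubfield L)} {J₁ : Matrix (Fin 1) (Fin 1) L} (hT₁ : IsUnit T₁.det)
  (hJ₁ : J₁ = T₁.map (algebraMap (maximalRealSubfield L) L)) (hJ₁0 : J₁ 0 0 ≠ 0)

include hT₁ hJ₁ in
set_option synthInstance.maxHeartbeats 400000 in
set_option maxHeartbeats 4000000 in
/-- **`Θ_{ξ∘bar₁}(scaleT_{−1} s_{χ′}^{−T₀}) ≅ Θ_ξ(s_χ^{T₀}) ∘ bar`** at a non-split place: the identity map of `𝒮(L⁺_vⁿ)` descends to an isomorphism of coinvariants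
intertwining `rep (ξ∘bar₁) ω₂ (g)` with `rep ξ ω₁ (ḡ)` (★ P1u + ★ L4). [cite: Liu2021, App. D §D.1 Step 3 (l. 5221)] [cite: MoeglinVignerasWaldspurger1987, Chap. 2 II.2]
[cite: GelbartRogawski1991, §3.1 Remark p. 457 L4–13] -/
theorem exists_coinv_equiv_localPiGalConj (hn : 0 < n)
    (t : Fin n → maximalRealSubfield L) (hT₀t : T₀ = Matrix.diagonal t) (hT₀ : T₀.IsSymm) (hT₀d : IsUnit T₀.det)
    (hT₀' : T₀'.IsSymm) (hT₀'d : IsUnit T₀'.det) (hTT₀ : T₀' = ((-1 : (maximalRealSubfield L)ˣ) : maximalRealSubfield L) • T₀)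
    (hJ₀ : J₀ = T₀.map (algebraMap (maximalRealSubfield L) L)) (hJ₀' : J₀' = T₀'.map (algebraMap (maximalRealSubfield L) L))
    (hns : ∀ w : PlacesOver L v, IsCMField.complexConj L • w.1 = w.1)
    (χ χ' : HeckeCharacter L) (hχ : IsSplittingChar L 1 χ) (hχ' : IsSplittingChar L 1 χ')
    (hχχ' : ∀ (w : PlacesOver L v),
      (χ'.localComponent w.1)⁻¹ = (χ.localComponent w.1)⁻¹.comp
        (Units.map (galAdicCompletionMap (L := L) (IsCMField.complexConj L) (hns w) : w.1.adicCompletion L →* w.1.adicCompletion L)))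
    (m : LocalMp (maximalRealSubfield L) (n + n) (gramD (maximalRealSubfield L) n T₀) v)
    (hm : (deltaLagrangian (maximalRealSubfield L) v n).map (toLin (maximalRealSubfield L) v (MpPsi.proj _ m)) =
      lagrangianY (maximalRealSubfield L) (n + n) v)
    (ξ : UnitaryGroup.localPi L (IsCMField.complexConj L) 1 J₁ v →* ℂˣ) :
    ∃ e : Coinv (((MpPsi.toRep (localSchrodinger (maximalRealSubfield L) n T₀ v)).comp
            (scaleTransportSection (maximalRealSubfield L) L (IsCMField.complexConj L) n (complexConj_imagUnit L) (imagUnit_ne_zero L)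
              (imagUnit_mul_self L) T₀ T₀' hT₀ hT₀' (-1) hTT₀ hJ₀ hJ₀' v (localSplittingCMWith L n hT₀' hT₀'d hJ₀' χ' hχ' v μ)
              (proj_localSplittingCMWith L n hT₀' hT₀'d hJ₀' χ' hχ' v μ))).comp (localCenter L (IsCMField.complexConj L) n J₀ J₁ hJ₁0 v)) (ξ.comp (localPiGalConj L (IsCMField.complexConj L) 1 v hJ₁)) ≃ₗ[ℂ] Coinv (((MpPsi.toRep (localSchrodinger (maximalRealSubfield L) n T₀ v)).comp (localSplittingCMWith L n hT₀ hT₀d hJ₀ χ hχ v μ)).comp (localCenter L (IsCMField.complexConj L) n J₀ J₁ hJ₁0 v)) ξ,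
      ∀ (g : UnitaryGroup.localPi L (IsCMField.complexConj L) n J₀ v) (x : Coinv (((MpPsi.toRep (localSchrodinger (maximalRealSubfield L) n T₀ v)).comp
            (scaleTransportSection (maximalRealSubfield L) L (IsCMField.complexConj L) n (complexConj_imagUnit L) (imagUnit_ne_zero L)
              (imagUnit_mul_self L) T₀ T₀' hT₀ hT₀' (-1) hTT₀ hJ₀ hJ₀' v (localSplittingCMWith L n hT₀' hT₀'d hJ₀' χ' hχ' v μ)
              (proj_localSplittingCMWith L n hT₀' hT₀'d hJ₀' χ' hχ' v μ))).comp (localCenter L (IsCMField.complexConj L) n J₀ J₁ hJ₁0 v)) (ξ.comp (localPiGalConj L (IsCMField.complexConj L) 1 v hJ₁))),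
        e (rep (ξ.comp (localPiGalConj L (IsCMField.complexConj L) 1 v hJ₁)) ((MpPsi.toRep (localSchrodinger (maximalRealSubfield L) n T₀ v)).comp
            (scaleTransportSection (maximalRealSubfield L) L (IsCMField.complexConj L) n (complexConj_imagUnit L) (imagUnit_ne_zero L)
              (imagUnit_mul_self L) T₀ T₀' hT₀ hT₀' (-1) hTT₀ hJ₀ hJ₀' v (localSplittingCMWith L n hT₀' hT₀'d hJ₀' χ' hχ' v μ)
              (proj_localSplittingCMWith L n hT₀' hT₀'d hJ₀' χ' hχ' v μ))) (commute_comp_localCenter' hJ₁0 ((MpPsi.toRep (localSchrodinger (maximalRealSubfield L) n T₀ v)).comp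
            (scaleTransportSection (maximalRealSubfield L) L (IsCMField.complexConj L) n (complexConj_imagUnit L) (imagUnit_ne_zero L)
              (imagUnit_mul_self L) T₀ T₀' hT₀ hT₀' (-1) hTT₀ hJ₀ hJ₀' v (localSplittingCMWith L n hT₀' hT₀'d hJ₀' χ' hχ' v μ)
              (proj_localSplittingCMWith L n hT₀' hT₀'d hJ₀' χ' hχ' v μ)))) g x) =
          rep ξ ((MpPsi.toRep (localSchrodinger (maximalRealSubfield L) n T₀ v)).comp (localSplittingCMWith L n hT₀ hT₀d hJ₀ χ hχ v μ)) (commute_comp_localCenter' hJ₁0 ((MpPsi.toRep (localSchrodinger (maximalRealSubfield L) n T₀ v)).comp (localSplittingCMWith L n hT₀ hT₀d hJ₀ χ hχ v μ))) ((localPiGalConj L (IsCMField.complexConj L) n v hJ₀) g) (e x) := by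
  -- ★ P1u: `ω₁ ∘ bar = ω₂` as representations
  have hP1u : ((MpPsi.toRep (localSchrodinger (maximalRealSubfield L) n T₀ v)).comp
            (scaleTransportSection (maximalRealSubfield L) L (IsCMField.complexConj L) n (complexConj_imagUnit L) (imagUnit_ne_zero L)
              (imagUnit_mul_self L) T₀ T₀' hT₀ hT₀' (-1) hTT₀ hJ₀ hJ₀' v (localSplittingCMWith L n hT₀' hT₀'d hJ₀' χ' hχ' v μ)
              (proj_localSplittingCMWith L n hT₀' hT₀'d hJ₀' χ' hχ' v μ))) = ((MpPsi.toRep (localSchrodinger (maximalRealSubfield L) n T₀ v)).comp (localSplittingCMWith L n hT₀ hT₀d hJ₀ χ hχ v μ)).comp (localPiGalConj L (IsCMField.complexConj L) n v hJ₀) := by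
    rw [MonoidHom.comp_assoc, localSplittingCMWith_comp_localPiGalConj_eq_scaleTransportSection L v μ n hn t hT₀t hT₀ hT₀d hT₀' hT₀'d hTT₀ hJ₀ hJ₀'
      hns χ χ' hχ hχ' hχχ' m hm]
  exact Literature.RepresentationTheory.TwistedCoinv.exists_equiv_of_comp_of_ker_eq ((MpPsi.toRep (localSchrodinger (maximalRealSubfield L) n T₀ v)).comp (localSplittingCMWith L n hT₀ hT₀d hJ₀ χ hχ v μ))
    ((MpPsi.toRep (localSchrodinger (maximalRealSubfield L) n T₀ v)).comp
            (scaleTransportSection (maximalRealSubfield L) L (IsCMField.complexConj L) n (complexConj_imagUnit L) (imagUnit_ne_zero L)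
              (imagUnit_mul_self L) T₀ T₀' hT₀ hT₀' (-1) hTT₀ hJ₀ hJ₀' v (localSplittingCMWith L n hT₀' hT₀'d hJ₀' χ' hχ' v μ)
              (proj_localSplittingCMWith L n hT₀' hT₀'d hJ₀' χ' hχ' v μ)))
    (localPiGalConj L (IsCMField.complexConj L) n v hJ₀) hP1u (localCenter L (IsCMField.complexConj L) n J₀ J₁ hJ₁0 v) ξ (ξ.comp (localPiGalConj L (IsCMField.complexConj L) 1 v hJ₁))
    (by rw [hP1u]; exact ker_comp_localPiGalConj_eq hJ₀ hT₁ hJ₁ hJ₁0 ((MpPsi.toRep (localSchrodinger (maximalRealSubfield L) n T₀ v)).comp (localSplittingCMWith L n hT₀ hT₀d hJ₀ χ hχ v μ)) ξ) _ _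

end CM

end Literature.NumberTheory.GelbartRogawski1991.UnitaryDualPair.LocalSplitting

end
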